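import Mathlib
import HarnessLib
import Summits.Ventures.LatticeQCDFlow.Exactness.NCMCGeneralSpaceMonotoneRootCLT
import Summits.Ventures.LatticeQCDFlow.Exactness.NCMCGeneralSpaceBarPairsEveryStart
import Summits.Ventures.LatticeQCDFlow.Exactness.NCMCGeneralSpaceIndicatorCLT

/-!
# The central limit theorem for the root of a monotone estimating equation ALONG A MARKOV CHAIN with a Doeblin power, from every initial law: `√n (d̂_n − d⋆) ⇒ N(0, σ²_GK(ψ_{d⋆}) / (E_π φ)²)`

HONEST FRAMING: exact (Metropolis-corrected) sampling algorithms for lattice gauge theory;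
figures of merit are autocorrelation/cost numbers at stated couplings and volumes; no
continuum-physics claim.

Venture `LatticeQCDFlow` (cell pub-lqcd), topic `Exactness`; FANOUT row 13 (`eng-snf`, GEN-22).
NEW WORK of the cell, not a published result; no definition is introduced; nothing is cited as a
fact (the "sandwich" variance of Z-estimators from dependent data is NAMED ONLY).  GEN-15's
`NCMCGeneralSpaceMonotoneRootCLT.tendstoInDistribution_sqrt_mul_root_sub` is the CLT for the root of
a monotone sample equation `Σ_{i<n} ψ_d(ω_i) = 0` along an INDEPENDENT run; GEN-18's
`tendsto_root_anyLaw_of_nHit_minorised` is the consistency of such roots along a Markov chain with a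
Doeblin power from every initial law (the BAR lane with correlated starts).  This file is the CLT
along the chain: the same exact linearisation (`abs_div_add_inv_lt'`, GEN-15), with GEN-19's
Markov-chain CLT under a Doeblin power (`tendstoInDistribution_timeAverage_of_nHit`) in place of
Mathlib's i.i.d. CLT and GEN-18's every-start strong law (`tendsto_sum_div_anyLaw_of_nHit_minorised`)
in place of the i.i.d. one.  The noise term is the Green–Kubo variance of `ψ_{d⋆}` along the chain
instead of `Var_π ψ_{d⋆}`; the sensitivity `E_π φ` is unchanged.  Instance (companion file
`NCMCGeneralSpaceBarRestartChainsCLT`): the engine's BAR estimate from two independent streams of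
correlated launches.

## Content (`κ` Markov on `X`, `π` invariant, `(nHit κ m)(z, ·) ≥ ε ν` ∀ `z`, `ε ≠ 0`, `0 < m`;
## `ψ_d` measurable, `π`-integrable, strictly increasing in `d`, `E_π ψ_{d⋆} = 0`, `|ψ_{d⋆}| ≤ C_ψ`;
## `φ` measurable with `|φ| ≤ C_φ`, `E_π φ > 0`; Taylor bound `|ψ_{d'} − ψ_{d⋆} − φ (d' − d⋆)| ≤ L (d' − d⋆)²`;
## `d̂_n` ANY measurable root selection; `μ₀` ANY initial law)

* **`tendstoInDistribution_sqrt_mul_root_sub_of_nHit`** — for every `Y` with law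
  `N(0, σ²/(E_π φ)²)`, `σ² = ∫ ψ_{d⋆}² dπ + 2 Σ_{k≥0} ∫ ψ_{d⋆} · (kop κ)^[k+1] ψ_{d⋆} dπ`:
  `√n (d̂_n − d⋆) ⇒ Y` under the chain law from `μ₀`.

NOT CLAIMED: unbounded `ψ_{d⋆}` or `φ`; a rate; studentization; `σ² > 0`.
-/

namespace Summit.Ventures.LatticeQCDFlow.Exactness.GeneralNCMC

open MeasureTheory ProbabilityTheory Set Filter Finset
open scoped ENNReal NNReal Topology

section Chain

variable {X : Type*} [MeasurableSpace X]
variable {κ : Kernel X X} [IsMarkovKernel κ] {π : Measure X} [IsProbabilityMeasure π]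
  {ν : Measure X} [IsProbabilityMeasure ν] {ε : ℝ≥0∞} {m : ℕ}
variable {ψ : ℝ → X → ℝ}
variable {Ω' : Type*} [MeasurableSpace Ω'] {P' : Measure Ω'} [IsProbabilityMeasure P']

/-- **ASYMPTOTIC NORMALITY OF THE ROOT OF A MONOTONE ESTIMATING EQUATION ALONG A MARKOV CHAIN WITH A
DOEBLIN POWER, FROM EVERY INITIAL LAW.**  With the setting of the module docstring and ANY measurable
root selection `d̂_n` (`Σ_{i<n} ψ_{d̂_n(ω)}(ω i) = 0` for `n ≥ 1`): for every `Y` with law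
`N(0, σ²/(E_π φ)²)` (`σ²` the Green–Kubo variance of `ψ_{d⋆}` along the chain),
`√n (d̂_n − d⋆) ⇒ Y` under the chain law from `μ₀`. -/
theorem tendstoInDistribution_sqrt_mul_root_sub_of_nHit (hπ : Kernel.Invariant κ π) (hε : ε ≠ 0)
    (hmin : ∀ z, ε • ν ≤ nHit κ m z) (hm : 0 < m)
    (hmeas : ∀ d, Measurable (ψ d)) (hstrict : ∀ x, StrictMono fun d => ψ d x)
    (hint : ∀ d, Integrable (ψ d) π) {dstar : ℝ} (hroot : ∫ x, ψ dstar x ∂π = 0)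
    {Cψ : ℝ} (hCψ : ∀ x, |ψ dstar x| ≤ Cψ)
    {φ : X → ℝ} (hφm : Measurable φ) {Cφ : ℝ} (hCφ : ∀ x, |φ x| ≤ Cφ) (hκ : 0 < ∫ x, φ x ∂π)
    {L : ℝ} (hL : 0 ≤ L)
    (htaylor : ∀ x d', |ψ d' x - ψ dstar x - φ x * (d' - dstar)| ≤ L * (d' - dstar) ^ 2)
    {dhat : ℕ → (ℕ → X) → ℝ} (hdm : ∀ n, Measurable (dhat n))
    (hdhat : ∀ n, 1 ≤ n → ∀ ω, ∑ i ∈ range n, ψ (dhat n ω) (ω i) = 0)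
    (μ₀ : Measure X) [IsProbabilityMeasure μ₀] {Y : Ω' → ℝ}
    (hY : HasLaw Y (gaussianReal 0 (Real.toNNReal
      (((∫ x, ψ dstar x ^ 2 ∂π) + 2 * ∑' k, ∫ x, ψ dstar x * (Scoring.kop κ)^[k + 1] (ψ dstar) x ∂π)
        / (∫ x, φ x ∂π) ^ 2))) P')
    [IsProbabilityMeasure (Kernel.trajMeasure (X := fun _ : ℕ => X) μ₀
        (fun n : ℕ => κ.comap (fun hh : (i : ↥(Finset.Iic n)) → X => hh ⟨n, Finset.mem_Iic.2 le_rfl⟩)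
          (measurable_pi_apply _)))] :
    TendstoInDistribution (fun (n : ℕ) (ω : ℕ → X) => √(n : ℝ) * (dhat n ω - dstar)) atTop Y
      (fun _ => Kernel.trajMeasure (X := fun _ : ℕ => X) μ₀
        (fun n : ℕ => κ.comap (fun hh : (i : ↥(Finset.Iic n)) → X => hh ⟨n, Finset.mem_Iic.2 le_rfl⟩)
          (measurable_pi_apply _))) P' := by
  set P := Kernel.trajMeasure (X := fun _ : ℕ => X) μ₀
    (fun n : ℕ => κ.comap (fun hh : (i : ↥(Finset.Iic n)) → X => hh ⟨n, Finset.mem_Iic.2 le_rfl⟩)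
      (measurable_pi_apply _)) with hP
  set K := ∫ x, φ x ∂π with hKdef
  set σ2 : ℝ := (∫ x, ψ dstar x ^ 2 ∂π)
    + 2 * ∑' k, ∫ x, ψ dstar x * (Scoring.kop κ)^[k + 1] (ψ dstar) x ∂π with hσ2
  -- Step 1: the chain CLT for the time average of `ψ_{d⋆}`, against `−K Y ~ N(0, σ²)`
  have hY₀ : HasLaw (fun ω' => -K * Y ω') (gaussianReal 0 σ2.toNNReal) P' := by
    rcases le_or_gt 0 σ2 with hσ | hσ
    · exact hasLaw_const_mul_gaussianReal hσ hκ.ne' (neg_sq K) hY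
    · have h1 : (σ2 / K ^ 2).toNNReal = 0 :=
        Real.toNNReal_of_nonpos (div_nonpos_of_nonpos_of_nonneg hσ.le (sq_nonneg _))
      have h2 : σ2.toNNReal = 0 := Real.toNNReal_of_nonpos hσ.le
      rw [h1] at hY
      rw [h2]
      have h := gaussianReal_const_mul hY (-K)
      rw [mul_zero] at h
      convert h using 2
      simp
  have hYX : HasLaw (fun ω' => -K * Y ω') (gaussianReal 0 (Real.toNNReal
      ((∫ y, (ψ dstar y - ∫ z, ψ dstar z ∂π) ^ 2 ∂π) + 2 * ∑' k, ∫ y, (ψ dstar y - ∫ z, ψ dstar z ∂π)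
        * (Scoring.kop κ)^[k + 1] (fun y => ψ dstar y - ∫ z, ψ dstar z ∂π) y ∂π))) P' := by
    simp_rw [hroot, sub_zero]
    exact hY₀
  have hX := tendstoInDistribution_timeAverage_of_nHit hπ hε hmin hm (hmeas dstar) hCψ μ₀ hYX
  simp_rw [hroot, sub_zero] at hX
  -- in the `√n · sampleMean` form
  have clt : TendstoInDistribution (fun (n : ℕ) (ω : ℕ → X) =>
      √(n : ℝ) * (sampleMean (ψ dstar) (fun i : Fin n => ω i) - 0)) atTop (fun ω' => -K * Y ω')
      (fun _ => P) P' := by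
    refine hX.congr (fun n => Eventually.of_forall fun ω => ?_) Filter.EventuallyEq.rfl
    simp only [sampleMean]
    rw [Fin.sum_univ_eq_sum_range (fun i => ψ dstar (ω i)) n]
    have h := sqrt_mul_mean_sub_eq (fun i => ψ dstar (ω i)) 0 n
    simp only [sub_zero] at h ⊢
    exact h.symm
  -- Step 2: `Z_n = (d̂_n − d⋆)/S̄_n(d⋆) → −K⁻¹` almost surely, from every start
  set Z : ℕ → (ℕ → X) → ℝ := fun n ω =>
    if sampleMean (ψ dstar) (fun i : Fin n => ω i) = 0 then -K⁻¹
    else (dhat n ω - dstar) / sampleMean (ψ dstar) (fun i : Fin n => ω i) with hZ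
  have hZmeas : ∀ n, Measurable (Z n) := fun n =>
    Measurable.ite (measurableSet_eq_fun (measurable_sampleMean_run (hmeas dstar) n) measurable_const)
      measurable_const (((hdm n).sub_const dstar).div (measurable_sampleMean_run (hmeas dstar) n))
  have hroot' : ∀ n, 1 ≤ n → ∀ ω : ℕ → X,
      sampleMean (ψ (dhat n ω)) (fun i : Fin n => ω i) = 0 := fun n hn ω => by
    unfold sampleMean
    rw [Fin.sum_univ_eq_sum_range (fun i => ψ (dhat n ω) (ω i)) n, hdhat n hn ω, zero_div]
  have hlin : ∀ n, 1 ≤ n → ∀ ω : ℕ → X,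
      |sampleMean (ψ dstar) (fun i : Fin n => ω i) +
        sampleMean φ (fun i : Fin n => ω i) * (dhat n ω - dstar)| ≤ L * (dhat n ω - dstar) ^ 2 := by
    intro n hn ω
    have hsm : sampleMean (fun x => ψ (dhat n ω) x - ψ dstar x - φ x * (dhat n ω - dstar))
        (fun i : Fin n => ω i) =
        sampleMean (ψ (dhat n ω)) (fun i : Fin n => ω i) - sampleMean (ψ dstar) (fun i : Fin n => ω i) -
          sampleMean φ (fun i : Fin n => ω i) * (dhat n ω - dstar) := by
      unfold sampleMean
      rw [sum_sub_distrib, sum_sub_distrib, ← sum_mul]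
      have hn' : (n : ℝ) ≠ 0 := by exact_mod_cast (show n ≠ 0 by omega)
      field_simp
    have hb := abs_sampleMean_le (F := fun x => ψ (dhat n ω) x - ψ dstar x - φ x * (dhat n ω - dstar))
      (y := fun i : Fin n => ω i) (B := L * (dhat n ω - dstar) ^ 2) (by positivity)
      (fun i => htaylor (ω i) (dhat n ω))
    rw [hsm, hroot' n hn ω, zero_sub] at hb
    rw [show sampleMean (ψ dstar) (fun i : Fin n => ω i) +
        sampleMean φ (fun i : Fin n => ω i) * (dhat n ω - dstar) =
      -(-sampleMean (ψ dstar) (fun i : Fin n => ω i) -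
        sampleMean φ (fun i : Fin n => ω i) * (dhat n ω - dstar)) by ring, abs_neg]
    exact hb
  -- consistency of the root and the strong law for `φ`, from every initial law
  have hcons : ∀ᵐ ω ∂P, Tendsto (fun n => dhat n ω) atTop (𝓝 dstar) := by
    have h := tendsto_root_anyLaw_of_nHit_minorised hπ hε hmin hmeas hstrict hint hroot μ₀
    rw [← hP] at h
    filter_upwards [h] with ω hω
    exact hω (fun n => dhat n ω) (eventually_atTop.2 ⟨1, fun n hn => hdhat n hn ω⟩)
  have hφlaw : ∀ᵐ ω ∂P, Tendsto (fun n : ℕ => sampleMean φ (fun i : Fin n => ω i)) atTop (𝓝 K) := by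
    have h := tendsto_sum_div_anyLaw_of_nHit_minorised hπ hε hmin hφm
      (Scoring.integrable_of_bounded π hφm hCφ) μ₀
    rw [← hP] at h
    filter_upwards [h] with ω hω
    refine hω.congr fun n => ?_
    unfold sampleMean
    rw [Fin.sum_univ_eq_sum_range (fun i => φ (ω i)) n]
  have hZae : ∀ᵐ ω ∂P, Tendsto (fun n => Z n ω) atTop (𝓝 (-K⁻¹)) := by
    filter_upwards [hcons, hφlaw] with ω hcons hωφ
    have hη : Tendsto (fun n => |sampleMean φ (fun i : Fin n => ω i) - K| + L * |dhat n ω - dstar|)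
        atTop (𝓝 0) := by
      have h1 : Tendsto (fun n => |sampleMean φ (fun i : Fin n => ω i) - K|) atTop (𝓝 0) := by
        have := (hωφ.sub_const K).abs
        rwa [sub_self, abs_zero] at this
      have h2 : Tendsto (fun n => L * |dhat n ω - dstar|) atTop (𝓝 0) := by
        have := ((hcons.sub_const dstar).abs).const_mul L
        rwa [sub_self, abs_zero, mul_zero] at this
      simpa using h1.add h2
    rw [Metric.tendsto_atTop]
    intro δ hδ
    have hδ1 : (0 : ℝ) < K / 2 := by positivity
    have hδ2 : (0 : ℝ) < δ * K ^ 2 / 2 := by positivity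
    obtain ⟨N, hN⟩ := (((hη.eventually (gt_mem_nhds hδ1)).and (hη.eventually (gt_mem_nhds hδ2))).and
      (eventually_ge_atTop 1)).exists_forall_of_atTop
    refine ⟨N, fun n hn => ?_⟩
    obtain ⟨⟨hn1, hn2⟩, hn3⟩ := hN n hn
    rw [Real.dist_eq]
    by_cases hg : sampleMean (ψ dstar) (fun i : Fin n => ω i) = 0
    · simp only [hZ, hg, ↓reduceIte, sub_self, abs_zero]
      exact hδ
    · simp only [hZ, hg, ↓reduceIte, sub_neg_eq_add]
      exact abs_div_add_inv_lt' hL hκ hδ hg (hlin n hn3 ω) hn1 hn2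
  have hZP : TendstoInMeasure P Z atTop (fun _ => -K⁻¹) :=
    tendstoInMeasure_of_tendsto_ae (fun n => (hZmeas n).aestronglyMeasurable) hZae
  -- Step 3: Slutsky and the exact identity
  have slutsky := clt.continuous_comp_prodMk_of_tendstoInMeasure_const
    (g := fun p : ℝ × ℝ => p.1 * p.2) (by fun_prop) hZP (fun n => (hZmeas n).aemeasurable)
  have hlim : (fun ω' => -K * Y ω' * -K⁻¹) = Y := by
    funext ω'
    field_simp
  simp only at slutsky
  rw [hlim] at slutsky
  refine slutsky.congr (fun n => Eventually.of_forall fun ω => ?_) EventuallyEq.rfl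
  rw [sub_zero]
  symm
  by_cases hg : sampleMean (ψ dstar) (fun i : Fin n => ω i) = 0
  · simp only [hZ, hg, ↓reduceIte, zero_mul, mul_zero]
    rcases Nat.eq_zero_or_pos n with rfl | hn
    · simp
    · have hsum0 : ∑ i ∈ range n, ψ dstar (ω i) = 0 := by
        have hg' := hg
        unfold sampleMean at hg'
        rw [Fin.sum_univ_eq_sum_range (fun i => ψ dstar (ω i)) n, div_eq_zero_iff] at hg'
        rcases hg' with hg' | hg'
        · exact hg'
        · exact absurd hg' (by exact_mod_cast hn.ne')
      have heq : dhat n ω = dstar :=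
        (rootSum_strictMono hstrict ω hn).injective ((hdhat n hn ω).trans hsum0.symm)
      rw [heq, sub_self, mul_zero]
  · simp only [hZ, hg, ↓reduceIte]
    rw [mul_assoc, mul_div_cancel₀ _ hg]

end Chain

end Summit.Ventures.LatticeQCDFlow.Exactness.GeneralNCMC
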